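import Mathlib
import HarnessLib

/-!
# Crux `PriceOfContractivity` (stmt-ValiantsHypothesis-10583), line `birth` — stub `stub_arcStep`

The single analytic step of the arc induction behind "max cycle geometric mean ≤ 240 R³ ×
principal-minor radius".  For an `(m+1) × (m+1)` complex matrix `A` with unit superdiagonal,
forward entries (strictly above the diagonal) of norm `≤ 1`, backward entries `A i j` (`j ≤ i`) of
length `i - j < m` bounded by `y (i - j)`, and `‖det A‖ ≤ δ ^ (m + 1)`, the corner entry
`A (Fin.last m) 0` (the unique backward entry of length `m`) satisfies `‖A (Fin.last m) 0‖ ≤ y m`,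
provided the two permutation sums of `y`-weights are small (these counting bounds are hypotheses
here).

Proof: Leibniz expansion `det A = ∑ σ, sign σ * ∏ i, A (σ i) i`, split by `σ 0 = Fin.last m`.
The permutations with `σ 0 = Fin.last m` contribute `A (Fin.last m) 0 * Q`, where the rotation
`(finRotate (m+1)).symm` contributes `± 1` to `Q` (its other factors are superdiagonal entries) and
the remaining ones contribute at most `3 / 2 - 1 = 1 / 2` in norm, so `‖Q‖ ≥ 1 / 2`; the
permutations with `σ 0 ≠ Fin.last m` contribute at most `y m / 4` in norm.  Hence
`‖A (Fin.last m) 0‖ / 2 ≤ δ ^ (m + 1) + y m / 4 ≤ y m / 2`.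
-/

-- single-conjunct layout: Sub = Summit, duplicated namespace component intended
set_option linter.dupNamespace false

namespace Summit.ValiantsHypothesis.ValiantsHypothesis.Theorems.PriceOfContractivity.ArcStep

open Finset

/-- A product of complex numbers whose factors indexed by `p` are bounded in norm by `g` and whose
other factors are bounded in norm by `1` has norm at most the product of `g` over the `p`-part.
[folklore] -/
theorem norm_prod_le_prod_filter {ι : Type*} (s : Finset ι) (p : ι → Prop) [DecidablePred p]
    (f : ι → ℂ) (g : ι → ℝ)
    (hp : ∀ i ∈ s, p i → ‖f i‖ ≤ g i) (hnp : ∀ i ∈ s, ¬ p i → ‖f i‖ ≤ 1) :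
    ‖∏ i ∈ s, f i‖ ≤ ∏ i ∈ s.filter p, g i := by
  rw [norm_prod, Finset.prod_filter]
  refine Finset.prod_le_prod (fun i _ => norm_nonneg _) (fun i hi => ?_)
  split_ifs with h
  · exact hp i hi h
  · exact hnp i hi h

/-- The sign of a permutation, cast to `ℂ`, has norm `1`. [folklore] -/
theorem norm_intCast_sign {n : Type*} [DecidableEq n] [Fintype n] (σ : Equiv.Perm n) :
    ‖((Equiv.Perm.sign σ : ℤ) : ℂ)‖ = 1 := by
  rcases Int.units_eq_one_or (Equiv.Perm.sign σ) with h | h <;> simp [h]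

/-- Multiplying by the sign of a permutation (cast to `ℂ`) does not change the norm. [folklore] -/
theorem norm_sign_mul {n : Type*} [DecidableEq n] [Fintype n] (σ : Equiv.Perm n) (x : ℂ) :
    ‖((Equiv.Perm.sign σ : ℤ) : ℂ) * x‖ = ‖x‖ := by
  rw [norm_mul, norm_intCast_sign, one_mul]

/-- A nonzero element of `Fin (m + 1)` has positive value. [folklore] -/
theorem val_pos_of_ne_zero {m : ℕ} {i : Fin (m + 1)} (hi : i ≠ 0) : 0 < i.val := by
  rcases Nat.eq_zero_or_pos i.val with h | h
  · exact absurd (Fin.ext (by simpa using h)) hi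
  · exact h

/-- Leibniz expansion of `det A` split according to whether `σ 0 = Fin.last m`: the permutations
with `σ 0 = Fin.last m` contribute `A (Fin.last m) 0` times a signed sum of products over the
remaining columns. [folklore] -/
theorem det_eq_corner_mul_add {m : ℕ} (A : Matrix (Fin (m + 1)) (Fin (m + 1)) ℂ) :
    A.det = A (Fin.last m) 0 *
        (∑ σ ∈ (Finset.univ : Finset (Equiv.Perm (Fin (m + 1)))).filter
            (fun σ => σ 0 = Fin.last m),
          ((Equiv.Perm.sign σ : ℤ) : ℂ) * ∏ i ∈ Finset.univ.erase 0, A (σ i) i) +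
      ∑ σ ∈ (Finset.univ : Finset (Equiv.Perm (Fin (m + 1)))).filter
          (fun σ => σ 0 ≠ Fin.last m),
        ((Equiv.Perm.sign σ : ℤ) : ℂ) * ∏ i, A (σ i) i := by
  rw [Matrix.det_apply', Finset.mul_sum,
    ← Finset.sum_filter_add_sum_filter_not Finset.univ
      (fun σ : Equiv.Perm (Fin (m + 1)) => σ 0 = Fin.last m)]
  congr 1
  refine Finset.sum_congr rfl (fun σ hσ => ?_)
  have hσ0 : σ 0 = Fin.last m := (Finset.mem_filter.mp hσ).2
  have hsplit : ∏ i, A (σ i) i = A (σ 0) 0 * ∏ i ∈ Finset.univ.erase 0, A (σ i) i :=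
    (Finset.mul_prod_erase (Finset.univ : Finset (Fin (m + 1))) (fun i => A (σ i) i)
      (Finset.mem_univ 0)).symm
  rw [hsplit, hσ0]
  ring

/-- Norm bound for the Leibniz term of a permutation with `σ 0 ≠ Fin.last m`: every backward
factor has length `< m`, so it is bounded by the corresponding `y`-weight, and forward factors are
bounded by `1`. [folklore] -/
theorem norm_prod_le_weight {m : ℕ} (A : Matrix (Fin (m + 1)) (Fin (m + 1)) ℂ) (y : ℕ → ℝ)
    (hfwd : ∀ i j : Fin (m + 1), i.val < j.val → ‖A i j‖ ≤ 1)
    (hback : ∀ i j : Fin (m + 1), j.val ≤ i.val → i.val - j.val < m →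
      ‖A i j‖ ≤ y (i.val - j.val))
    (σ : Equiv.Perm (Fin (m + 1))) (hσ : σ 0 ≠ Fin.last m) :
    ‖∏ i, A (σ i) i‖ ≤
      ∏ i ∈ (Finset.univ : Finset (Fin (m + 1))).filter (fun i => i.val ≤ (σ i).val),
        y ((σ i).val - i.val) := by
  refine norm_prod_le_prod_filter _ _ _ _ (fun i _ hp => ?_) (fun i _ hp => ?_)
  · refine hback (σ i) i hp ?_
    have hlt := (σ i).isLt
    by_cases hi0 : i = 0
    · subst hi0
      have hne : (σ 0).val ≠ m := fun h => hσ (Fin.ext (by rw [h, Fin.val_last]))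
      omega
    · have hpos := val_pos_of_ne_zero hi0
      omega
  · exact hfwd (σ i) i (by omega)

/-- Norm bound for the Leibniz term of a permutation with the column `0` removed: backward factors
in columns `i ≠ 0` have length `< m` and are bounded by the `y`-weight, forward factors by `1`.
[folklore] -/
theorem norm_prod_erase_le_weight {m : ℕ} (A : Matrix (Fin (m + 1)) (Fin (m + 1)) ℂ) (y : ℕ → ℝ)
    (hfwd : ∀ i j : Fin (m + 1), i.val < j.val → ‖A i j‖ ≤ 1)
    (hback : ∀ i j : Fin (m + 1), j.val ≤ i.val → i.val - j.val < m →
      ‖A i j‖ ≤ y (i.val - j.val))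
    (σ : Equiv.Perm (Fin (m + 1))) :
    ‖∏ i ∈ Finset.univ.erase 0, A (σ i) i‖ ≤
      ∏ i ∈ (Finset.univ : Finset (Fin (m + 1))).filter (fun i => i ≠ 0 ∧ i.val ≤ (σ i).val),
        y ((σ i).val - i.val) := by
  have hset : (Finset.univ : Finset (Fin (m + 1))).filter (fun i => i ≠ 0 ∧ i.val ≤ (σ i).val) =
      (Finset.univ.erase 0).filter (fun i => i.val ≤ (σ i).val) := by
    ext i
    simp [Finset.mem_filter, Finset.mem_erase]
  rw [hset]
  refine norm_prod_le_prod_filter _ _ _ _ (fun i hi hp => ?_) (fun i _ hp => ?_)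
  · have hpos := val_pos_of_ne_zero (Finset.ne_of_mem_erase hi)
    have hlt := (σ i).isLt
    exact hback (σ i) i hp (by omega)
  · exact hfwd (σ i) i (by omega)

/-- The inverse rotation sends `0` to `Fin.last m`. [folklore] -/
theorem finRotate_symm_zero (m : ℕ) : (finRotate (m + 1)).symm 0 = Fin.last m := by
  rw [Equiv.symm_apply_eq]
  exact finRotate_last.symm

/-- Along the inverse rotation, the Leibniz factors in the columns `i ≠ 0` are the superdiagonal
entries, hence their product is `1` for a matrix with unit superdiagonal. [folklore] -/
theorem prod_erase_rotate_eq_one {m : ℕ} (A : Matrix (Fin (m + 1)) (Fin (m + 1)) ℂ)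
    (hsuper : ∀ (t : ℕ) (h : t + 1 < m + 1), A ⟨t, by omega⟩ ⟨t + 1, h⟩ = 1) :
    ∏ i ∈ Finset.univ.erase 0, A ((finRotate (m + 1)).symm i) i = 1 := by
  refine Finset.prod_eq_one (fun i hi => ?_)
  have hi0 : i ≠ 0 := Finset.ne_of_mem_erase hi
  have hval : ((finRotate (m + 1)).symm i).val = i.val - 1 := coe_finRotate_symm_of_ne_zero hi0
  have hpos := val_pos_of_ne_zero hi0
  have hlt := i.isLt
  have key := hsuper (i.val - 1) (by omega)
  convert key using 2
  · exact Fin.ext (by rw [hval])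
  · exact Fin.ext (by simp only; omega)

/-- Along the inverse rotation no column `i ≠ 0` carries a backward factor, so its `y`-weight
(restricted to the columns `i ≠ 0`) is the empty product. [folklore] -/
theorem filter_rotate_eq_empty (m : ℕ) :
    (Finset.univ : Finset (Fin (m + 1))).filter
        (fun i => i ≠ 0 ∧ i.val ≤ ((finRotate (m + 1)).symm i).val) = ∅ := by
  refine Finset.filter_eq_empty_iff.mpr (fun i _ h => ?_)
  obtain ⟨hi0, hle⟩ := h
  rw [coe_finRotate_symm_of_ne_zero hi0] at hle
  have hpos := val_pos_of_ne_zero hi0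
  omega

/-- **Arc step.** For an `(m+1) × (m+1)` complex matrix with unit superdiagonal, forward entries
of norm `≤ 1`, backward entries of length `< m` bounded by `y`, and `‖det A‖ ≤ δ ^ (m + 1)`, the
corner entry satisfies `‖A (Fin.last m) 0‖ ≤ y m`, provided `δ ^ (m + 1) ≤ y m / 4` and the two
permutation sums of `y`-weights are at most `y m / 4` and `3 / 2`. [folklore] -/
theorem stub_arcStep :
    ∀ (m : ℕ) (A : Matrix (Fin (m + 1)) (Fin (m + 1)) ℂ) (y : ℕ → ℝ) (δ : ℝ),
      1 ≤ m → 0 ≤ δ → (∀ l, 0 ≤ y l) →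
      (∀ (t : ℕ) (h : t + 1 < m + 1), A ⟨t, by omega⟩ ⟨t + 1, h⟩ = 1) →
      (∀ i j : Fin (m + 1), i.val < j.val → ‖A i j‖ ≤ 1) →
      ‖A.det‖ ≤ δ ^ (m + 1) →
      (∀ i j : Fin (m + 1), j.val ≤ i.val → i.val - j.val < m → ‖A i j‖ ≤ y (i.val - j.val)) →
      δ ^ (m + 1) ≤ y m / 4 →
      (∑ σ ∈ (Finset.univ : Finset (Equiv.Perm (Fin (m + 1)))).filter (fun σ => σ 0 ≠ Fin.last m),
          ∏ i ∈ (Finset.univ : Finset (Fin (m + 1))).filter (fun i => i.val ≤ (σ i).val),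
            y ((σ i).val - i.val)) ≤ y m / 4 →
      (∑ σ ∈ (Finset.univ : Finset (Equiv.Perm (Fin (m + 1)))).filter (fun σ => σ 0 = Fin.last m),
          ∏ i ∈ (Finset.univ : Finset (Fin (m + 1))).filter (fun i => i ≠ 0 ∧ i.val ≤ (σ i).val),
            y ((σ i).val - i.val)) ≤ 3 / 2 →
      ‖A (Fin.last m) 0‖ ≤ y m := by
  intro m A y δ _hm _hδ _hy hsuper hfwd hdet hback hδy hΦ hW
  -- the two pieces of the Leibniz expansion
  obtain ⟨Q, hQ⟩ : ∃ Q : ℂ, Q =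
      ∑ σ ∈ (Finset.univ : Finset (Equiv.Perm (Fin (m + 1)))).filter
          (fun σ => σ 0 = Fin.last m),
        ((Equiv.Perm.sign σ : ℤ) : ℂ) * ∏ i ∈ Finset.univ.erase 0, A (σ i) i := ⟨_, rfl⟩
  obtain ⟨R, hR⟩ : ∃ R : ℂ, R =
      ∑ σ ∈ (Finset.univ : Finset (Equiv.Perm (Fin (m + 1)))).filter
          (fun σ => σ 0 ≠ Fin.last m),
        ((Equiv.Perm.sign σ : ℤ) : ℂ) * ∏ i, A (σ i) i := ⟨_, rfl⟩
  have hdetEq : A.det = A (Fin.last m) 0 * Q + R := by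
    rw [hQ, hR]
    exact det_eq_corner_mul_add A
  -- the `σ 0 ≠ Fin.last m` part is small
  have hRle : ‖R‖ ≤ y m / 4 := by
    rw [hR]
    refine (norm_sum_le _ _).trans (le_trans (Finset.sum_le_sum (fun σ hσ => ?_)) hΦ)
    rw [norm_sign_mul]
    exact norm_prod_le_weight A y hfwd hback σ (Finset.mem_filter.mp hσ).2
  -- the `σ 0 = Fin.last m` part has norm at least `1 / 2`
  have hQge : 1 / 2 ≤ ‖Q‖ := by
    have hρF : (finRotate (m + 1)).symm ∈
        (Finset.univ : Finset (Equiv.Perm (Fin (m + 1)))).filter (fun σ => σ 0 = Fin.last m) :=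
      Finset.mem_filter.mpr ⟨Finset.mem_univ _, finRotate_symm_zero m⟩
    -- the weights of the other permutations sum to at most `1 / 2`
    have hWsplit := Finset.add_sum_erase _
      (fun σ : Equiv.Perm (Fin (m + 1)) =>
        ∏ i ∈ (Finset.univ : Finset (Fin (m + 1))).filter (fun i => i ≠ 0 ∧ i.val ≤ (σ i).val),
          y ((σ i).val - i.val)) hρF
    rw [filter_rotate_eq_empty m, Finset.prod_empty] at hWsplit
    -- the signed terms of the other permutations
    have hQsplit := Finset.add_sum_erase _
      (fun σ : Equiv.Perm (Fin (m + 1)) =>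
        ((Equiv.Perm.sign σ : ℤ) : ℂ) * ∏ i ∈ Finset.univ.erase 0, A (σ i) i) hρF
    rw [prod_erase_rotate_eq_one A hsuper, mul_one, ← hQ] at hQsplit
    have hle : ∑ σ ∈ ((Finset.univ : Finset (Equiv.Perm (Fin (m + 1)))).filter
          (fun σ => σ 0 = Fin.last m)).erase (finRotate (m + 1)).symm,
        ‖((Equiv.Perm.sign σ : ℤ) : ℂ) * ∏ i ∈ Finset.univ.erase 0, A (σ i) i‖ ≤
        ∑ σ ∈ ((Finset.univ : Finset (Equiv.Perm (Fin (m + 1)))).filter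
          (fun σ => σ 0 = Fin.last m)).erase (finRotate (m + 1)).symm,
          ∏ i ∈ (Finset.univ : Finset (Fin (m + 1))).filter (fun i => i ≠ 0 ∧ i.val ≤ (σ i).val),
            y ((σ i).val - i.val) := by
      refine Finset.sum_le_sum (fun σ _ => ?_)
      rw [norm_sign_mul]
      exact norm_prod_erase_le_weight A y hfwd hback σ
    have hrest : ‖∑ σ ∈ ((Finset.univ : Finset (Equiv.Perm (Fin (m + 1)))).filter
          (fun σ => σ 0 = Fin.last m)).erase (finRotate (m + 1)).symm,
        ((Equiv.Perm.sign σ : ℤ) : ℂ) * ∏ i ∈ Finset.univ.erase 0, A (σ i) i‖ ≤ 1 / 2 := by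
      refine (norm_sum_le _ _).trans ?_
      linarith
    have hsign : ((Equiv.Perm.sign (finRotate (m + 1)).symm : ℤ) : ℂ) =
        Q - ∑ σ ∈ ((Finset.univ : Finset (Equiv.Perm (Fin (m + 1)))).filter
          (fun σ => σ 0 = Fin.last m)).erase (finRotate (m + 1)).symm,
        ((Equiv.Perm.sign σ : ℤ) : ℂ) * ∏ i ∈ Finset.univ.erase 0, A (σ i) i := by
      rw [← hQsplit]
      ring
    have h1 := norm_intCast_sign (finRotate (m + 1)).symm
    rw [hsign] at h1
    have h2 := norm_sub_le Q (∑ σ ∈ ((Finset.univ : Finset (Equiv.Perm (Fin (m + 1)))).filter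
          (fun σ => σ 0 = Fin.last m)).erase (finRotate (m + 1)).symm,
        ((Equiv.Perm.sign σ : ℤ) : ℂ) * ∏ i ∈ Finset.univ.erase 0, A (σ i) i)
    linarith
  -- conclude
  have hprod : ‖A (Fin.last m) 0‖ * ‖Q‖ ≤ y m / 2 := by
    have hmul : A (Fin.last m) 0 * Q = A.det - R := by
      rw [hdetEq]
      ring
    calc ‖A (Fin.last m) 0‖ * ‖Q‖ = ‖A (Fin.last m) 0 * Q‖ := (norm_mul _ _).symm
      _ = ‖A.det - R‖ := by rw [hmul]
      _ ≤ ‖A.det‖ + ‖R‖ := norm_sub_le _ _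
      _ ≤ δ ^ (m + 1) + y m / 4 := add_le_add hdet hRle
      _ ≤ y m / 2 := by linarith
  nlinarith [norm_nonneg (A (Fin.last m) 0), norm_nonneg Q]

end Summit.ValiantsHypothesis.ValiantsHypothesis.Theorems.PriceOfContractivity.ArcStep
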